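import Mathlib
import Summits.ResolutionOfSingularities.ResolutionOfSingularities.Theorems.WeightedInvariantLocalWeightedDropNCResApexColumnB

/-!
# `WeightedInvariant.LocalWeightedDrop` ENGINE, W′|₄ line — D₃ᴮ object (11): res-L1-w43-strat-1's `stub_surfaceBoundaryNC₃` MODULO THE TANGENT ENDGAME

Sub-problem `ResolutionOfSingularities`, ENGINE crux `stmt-ResolutionOfSingularities-8899` (`LocalWeightedDrop`), registered stub W′|₄
`stub_wildWideApexFourStartsWon`; res-L1-w43-strat-1's SNC₂ interface `g11/snc2_interface_v1.lean` (stub `stub_surfaceBoundaryNC₃`, the D₃ᴮ input of the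
x₀-lift `stub_pairLift`), res-L1-w43-plan-1 RULINGS 2026-08-27T21:45:42Z / 22:28:19Z (binders `∀ p prime, ∀ k [Field k] [CharP k p] [IsAlgClosed k]`).
[OURS · L1 W4.3 · chain w43 · res-L1-w43-lead-1 g6; def-free; a binder adapter over `surfaceBoundaryNC_of_tangentB` (…NCResApexColumnB); nothing here is a
statement of any manuscript; AI-produced, gate-checked, weaker than expert review.]

* **`surfaceBoundaryNC₃_of_tangentB`** — THE TEXT OF `stub_surfaceBoundaryNC₃` (under its own binders, history hypothesis `δ.O = ∅` kept but idle) from the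
  ONE residual hypothesis of the D₃ᴮ lane, the tangent endgame `hT` taken under the same binders:
  `∀ p prime, ∀ k, ∀ b δ, Admissible b δ → δ.o = 1 → (∀ j ∉ δ.E, coeff (single j 1) δ.f = 0) → DBWinsTo «NC ∨ (admissible ∧ head drop)» (b, δ)`.
-/

set_option linter.dupNamespace false -- mandated namespace of this single-conjunct summit

noncomputable section

namespace Summit.ResolutionOfSingularities.ResolutionOfSingularities.Theorems

namespace TameFourTupleDrop

open MvPowerSeries Literature.AlgebraicGeometry.Resolution

/-- **res-L1-w43-strat-1's `stub_surfaceBoundaryNC₃` MODULO THE TANGENT ENDGAME**: over every algebraically closed field of prime characteristic, from every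
admissibly decorated position of the three-letter NC game (the stub asks only for those without history) the mover B-forces a normal crossing — given the
tangent case of the `o = 1` endgame.  Regimes (H) (P) (L) (B), the `o ≥ 2 → o ≤ 1` assembly and the endgame's exits (T0) (T1) are tree theorems in B-form. -/
theorem surfaceBoundaryNC₃_of_tangentB
    (hT : ∀ (p : ℕ), p.Prime → ∀ (k : Type) [Field k] [CharP k p] [IsAlgClosed k],
      ∀ (b : MvPowerSeries (Fin 3) k) (δ : Decoration k 2), Admissible b δ → δ.o = 1 →
        (∀ j, j ∉ δ.E → coeff (Finsupp.single j 1) δ.f = 0) →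
        DBWinsTo (fun τ => GermIsNC τ.1 ∨ (Admissible τ.1 τ.2 ∧ τ.2.head < δ.head)) (b, δ)) :
    ∀ (p : ℕ), p.Prime → ∀ (k : Type) [Field k] [CharP k p] [IsAlgClosed k],
      ∀ (b : MvPowerSeries (Fin 3) k) (δ : Decoration k 2), Admissible b δ → δ.O = ∅ →
        DBWinsTo (fun τ : MvPowerSeries (Fin 3) k × Decoration k 2 => GermIsNC τ.1) (b, δ) := by
  intro p hp k _ _ _ b δ hadm _
  haveI : Fact p.Prime := ⟨hp⟩
  exact surfaceBoundaryNC_of_tangentB p (hT p hp k) b δ hadm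

/-- The same WITHOUT the idle history hypothesis (every admissibly decorated position). -/
theorem surfaceBoundaryNC_of_tangentB_all
    (hT : ∀ (p : ℕ), p.Prime → ∀ (k : Type) [Field k] [CharP k p] [IsAlgClosed k],
      ∀ (b : MvPowerSeries (Fin 3) k) (δ : Decoration k 2), Admissible b δ → δ.o = 1 →
        (∀ j, j ∉ δ.E → coeff (Finsupp.single j 1) δ.f = 0) →
        DBWinsTo (fun τ => GermIsNC τ.1 ∨ (Admissible τ.1 τ.2 ∧ τ.2.head < δ.head)) (b, δ)) :
    ∀ (p : ℕ), p.Prime → ∀ (k : Type) [Field k] [CharP k p] [IsAlgClosed k],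
      ∀ (b : MvPowerSeries (Fin 3) k) (δ : Decoration k 2), Admissible b δ →
        DBWinsTo (fun τ : MvPowerSeries (Fin 3) k × Decoration k 2 => GermIsNC τ.1) (b, δ) := by
  intro p hp k _ _ _ b δ hadm
  haveI : Fact p.Prime := ⟨hp⟩
  exact surfaceBoundaryNC_of_tangentB p (hT p hp k) b δ hadm

end TameFourTupleDrop

end Summit.ResolutionOfSingularities.ResolutionOfSingularities.Theorems

end
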